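import Literature.Combinatorics.Sahi2008.Functional

/-!
# Conditional Harris for the three pairs ⇒ Sahi's `C_3` instance (Lemma CH3)

Companion of `SahiMasterFamily.lean` (crux `NoHeavyLowerTail`, stmt-CriticalPhenomena-4575; cell `prim-masterthm`,
unit `prim-masterthm-p5` = "Lorentzian / complete-log-concavity test").  Vocabulary: Sahi's functional
`Literature.Combinatorics.Sahi2008.sahiE` [Sahi2008; LiebSahi2021, Def. 3.1] with closed form `sahiE_three`:
`E_3(f,g,h) = 2E(fgh) + E(f)E(g)E(h) − (E(f)E(gh) + E(g)E(fh) + E(h)E(fg))`.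

OUTCOME OF THE TEST (report run/shared/lean/prim/prim-masterthm/prim-masterthm-p5/P5-LORENTZIAN-TEST.md): no Lorentzian
/ Rayleigh / stable polynomial built from the measure carries `E_k ≥ 0` (those classes encode NEGATIVE dependence, and the
sign-twisted generating function is Lorentzian for every event family); what the 2×2 "minor" conditions OF THE RIGHT SIGN give is
the following elementary sufficient condition, recorded here because it classifies which rows of the |A| = 5 dictionary are
already corollaries.  With `e₁ = E f`, `E₁₂ = E(fg)`, …, `E₁₂₃ = E(fgh)` the polynomial identity
  `3·e₁e₂e₃·E_3 = 2·Σ_i e_je_k·(e_iE₁₂₃ − E_{ij}E_{ik}) + e₁e₂e₃·Σ_i e_i(E_{jk} − e_je_k) + 2·Σ_i e_je_k(E_{ij} − e_ie_j)(E_{ik} − e_ie_k)`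
holds (`three_mul_prod_mul_cubicE3_eq`); for indicators of events `U_i` of a probability space, `e_iE₁₂₃ − E_{ij}E_{ik} =
e_i²·Cov(1_{U_j},1_{U_k} ∣ U_i)`.  Hence HARRIS for the three pairs together with CONDITIONAL HARRIS given each of the three
events implies `E_3 ≥ 0` (`cubicE3_nonneg_of_condHarris`, `sahiE_three_nonneg_of_condHarris`), with the explicit slack
`3e₁e₂e₃E_3 ≥ e₁e₂e₃Σe_i c_i + 2Σ e_je_k c_jc_k` (`three_mul_prod_mul_cubicE3_ge`).  HONEST FRAMING: conditional Harris FAILS for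
non-principal conditioning events under product measure (`(x₀, x₁ ∣ x₀ ∨ x₁)`), so this is a classifier of easy rows, not a route
to `C_3`; nothing here asserts `C_3`. [this work]
-/

namespace Summit.CriticalPhenomena.PercolationContinuityZ3.Theorems

open Literature.Combinatorics.Sahi2008

/-! ### The polynomial identity and the real-variable inequality -/

/-- **The CH3 identity.** For arbitrary reals (read `eᵢ = E(fᵢ)`, `E₁₂ = E(f₁f₂)`, …, `E₁₂₃ = E(f₁f₂f₃)`):
`3e₁e₂e₃·(2E₁₂₃ + e₁e₂e₃ − Σ eᵢE_{jk}) = 2Σ e_je_k(e_iE₁₂₃ − E_{ij}E_{ik}) + e₁e₂e₃Σ e_i(E_{jk} − e_je_k) + 2Σ e_je_k(E_{ij} − e_ie_j)(E_{ik} − e_ie_k)`.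
[this work] -/
theorem three_mul_prod_mul_cubicE3_eq (e₁ e₂ e₃ E₁₂ E₁₃ E₂₃ E₁₂₃ : ℝ) :
    3 * (e₁ * e₂ * e₃) * (2 * E₁₂₃ + e₁ * e₂ * e₃ - (e₁ * E₂₃ + e₂ * E₁₃ + e₃ * E₁₂)) =
      2 * (e₂ * e₃ * (e₁ * E₁₂₃ - E₁₂ * E₁₃) + e₁ * e₃ * (e₂ * E₁₂₃ - E₁₂ * E₂₃) +
            e₁ * e₂ * (e₃ * E₁₂₃ - E₁₃ * E₂₃)) +
        e₁ * e₂ * e₃ * (e₁ * (E₂₃ - e₂ * e₃) + e₂ * (E₁₃ - e₁ * e₃) + e₃ * (E₁₂ - e₁ * e₂)) +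
        2 * (e₂ * e₃ * ((E₁₃ - e₁ * e₃) * (E₁₂ - e₁ * e₂)) + e₁ * e₃ * ((E₂₃ - e₂ * e₃) * (E₁₂ - e₁ * e₂)) +
            e₁ * e₂ * ((E₂₃ - e₂ * e₃) * (E₁₃ - e₁ * e₃))) := by
  ring

/-- **Quantitative CH3.** Under the three conditional-Harris inequalities `E_{ij}E_{ik} ≤ e_iE₁₂₃` and `eᵢ ≥ 0`,
`3e₁e₂e₃·E_3 ≥ e₁e₂e₃·Σ e_i c_i + 2Σ e_je_k c_jc_k` with `c_i = E_{jk} − e_je_k`. [this work] -/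
theorem three_mul_prod_mul_cubicE3_ge {e₁ e₂ e₃ E₁₂ E₁₃ E₂₃ E₁₂₃ : ℝ} (h₁ : 0 ≤ e₁) (h₂ : 0 ≤ e₂) (h₃ : 0 ≤ e₃)
    (s₁ : E₁₂ * E₁₃ ≤ e₁ * E₁₂₃) (s₂ : E₁₂ * E₂₃ ≤ e₂ * E₁₂₃) (s₃ : E₁₃ * E₂₃ ≤ e₃ * E₁₂₃) :
    e₁ * e₂ * e₃ * (e₁ * (E₂₃ - e₂ * e₃) + e₂ * (E₁₃ - e₁ * e₃) + e₃ * (E₁₂ - e₁ * e₂)) +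
        2 * (e₂ * e₃ * ((E₁₃ - e₁ * e₃) * (E₁₂ - e₁ * e₂)) + e₁ * e₃ * ((E₂₃ - e₂ * e₃) * (E₁₂ - e₁ * e₂)) +
            e₁ * e₂ * ((E₂₃ - e₂ * e₃) * (E₁₃ - e₁ * e₃))) ≤
      3 * (e₁ * e₂ * e₃) * (2 * E₁₂₃ + e₁ * e₂ * e₃ - (e₁ * E₂₃ + e₂ * E₁₃ + e₃ * E₁₂)) := by
  rw [three_mul_prod_mul_cubicE3_eq]
  have t₁ : 0 ≤ e₂ * e₃ * (e₁ * E₁₂₃ - E₁₂ * E₁₃) := mul_nonneg (mul_nonneg h₂ h₃) (sub_nonneg.mpr s₁)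
  have t₂ : 0 ≤ e₁ * e₃ * (e₂ * E₁₂₃ - E₁₂ * E₂₃) := mul_nonneg (mul_nonneg h₁ h₃) (sub_nonneg.mpr s₂)
  have t₃ : 0 ≤ e₁ * e₂ * (e₃ * E₁₂₃ - E₁₃ * E₂₃) := mul_nonneg (mul_nonneg h₁ h₂) (sub_nonneg.mpr s₃)
  linarith

/-- **Lemma CH3 (real-variable form).** If `eᵢ > 0`, HARRIS holds for the three pairs (`e_je_k ≤ E_{jk}`) and CONDITIONAL
HARRIS holds given each event (`E_{ij}E_{ik} ≤ e_iE₁₂₃`, i.e. `Cov(1_j,1_k ∣ U_i) ≥ 0`), then Sahi's cubic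
`E_3 = 2E₁₂₃ + e₁e₂e₃ − Σ eᵢE_{jk}` is nonnegative. [this work] -/
theorem cubicE3_nonneg_of_condHarris {e₁ e₂ e₃ E₁₂ E₁₃ E₂₃ E₁₂₃ : ℝ} (h₁ : 0 < e₁) (h₂ : 0 < e₂) (h₃ : 0 < e₃)
    (c₁ : e₂ * e₃ ≤ E₂₃) (c₂ : e₁ * e₃ ≤ E₁₃) (c₃ : e₁ * e₂ ≤ E₁₂)
    (s₁ : E₁₂ * E₁₃ ≤ e₁ * E₁₂₃) (s₂ : E₁₂ * E₂₃ ≤ e₂ * E₁₂₃) (s₃ : E₁₃ * E₂₃ ≤ e₃ * E₁₂₃) :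
    0 ≤ 2 * E₁₂₃ + e₁ * e₂ * e₃ - (e₁ * E₂₃ + e₂ * E₁₃ + e₃ * E₁₂) := by
  have hprod : 0 < 3 * (e₁ * e₂ * e₃) := by positivity
  have key := three_mul_prod_mul_cubicE3_ge h₁.le h₂.le h₃.le s₁ s₂ s₃
  have hc₁ : 0 ≤ E₂₃ - e₂ * e₃ := sub_nonneg.mpr c₁
  have hc₂ : 0 ≤ E₁₃ - e₁ * e₃ := sub_nonneg.mpr c₂
  have hc₃ : 0 ≤ E₁₂ - e₁ * e₂ := sub_nonneg.mpr c₃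
  have u : 0 ≤ e₁ * e₂ * e₃ * (e₁ * (E₂₃ - e₂ * e₃) + e₂ * (E₁₃ - e₁ * e₃) + e₃ * (E₁₂ - e₁ * e₂)) := by
    have : 0 ≤ e₁ * (E₂₃ - e₂ * e₃) + e₂ * (E₁₃ - e₁ * e₃) + e₃ * (E₁₂ - e₁ * e₂) :=
      add_nonneg (add_nonneg (mul_nonneg h₁.le hc₁) (mul_nonneg h₂.le hc₂)) (mul_nonneg h₃.le hc₃)
    exact mul_nonneg (by positivity) this
  have w : 0 ≤ 2 * (e₂ * e₃ * ((E₁₃ - e₁ * e₃) * (E₁₂ - e₁ * e₂)) +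
      e₁ * e₃ * ((E₂₃ - e₂ * e₃) * (E₁₂ - e₁ * e₂)) + e₁ * e₂ * ((E₂₃ - e₂ * e₃) * (E₁₃ - e₁ * e₃))) := by
    have w₁ : 0 ≤ e₂ * e₃ * ((E₁₃ - e₁ * e₃) * (E₁₂ - e₁ * e₂)) :=
      mul_nonneg (mul_nonneg h₂.le h₃.le) (mul_nonneg hc₂ hc₃)
    have w₂ : 0 ≤ e₁ * e₃ * ((E₂₃ - e₂ * e₃) * (E₁₂ - e₁ * e₂)) :=
      mul_nonneg (mul_nonneg h₁.le h₃.le) (mul_nonneg hc₁ hc₃)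
    have w₃ : 0 ≤ e₁ * e₂ * ((E₂₃ - e₂ * e₃) * (E₁₃ - e₁ * e₃)) :=
      mul_nonneg (mul_nonneg h₁.le h₂.le) (mul_nonneg hc₁ hc₂)
    linarith
  have h3 : 0 ≤ 3 * (e₁ * e₂ * e₃) * (2 * E₁₂₃ + e₁ * e₂ * e₃ - (e₁ * E₂₃ + e₂ * E₁₃ + e₃ * E₁₂)) := by
    linarith
  exact (mul_nonneg_iff_of_pos_left hprod).mp h3

/-! ### The statement for Sahi's functional `E_3` -/

section Functional

variable {α : Type*} [Fintype α]

/-- **Lemma CH3 for `sahiE μ 3`.** For ANY weight `μ` and functions `f, g, h` with `E f, E g, E h > 0`: if the three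
Harris inequalities `E(g)E(h) ≤ E(gh)`, … and the three conditional-Harris inequalities `E(fg)E(fh) ≤ E(f)E(fgh)`, … hold,
then `E_3(f,g,h) ≥ 0`.  (For indicators of events under a probability weight the hypotheses read `Cov(1_{U_j},1_{U_k}) ≥ 0`
and `Cov(1_{U_j},1_{U_k} ∣ U_i) ≥ 0`; the former is Harris/FKG for increasing events, the latter FAILS in general for
non-principal `U_i` — e.g. `(x₀, x₁ ∣ x₀ ∨ x₁)` on two coins — so this classifies rows, it does not prove `C_3`.) [this work] -/
theorem sahiE_three_nonneg_of_condHarris (μ : α → ℝ) (f g h : α → ℝ)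
    (hf : 0 < ex μ f) (hg : 0 < ex μ g) (hh : 0 < ex μ h)
    (c₁ : ex μ g * ex μ h ≤ ex μ (g * h)) (c₂ : ex μ f * ex μ h ≤ ex μ (f * h))
    (c₃ : ex μ f * ex μ g ≤ ex μ (f * g))
    (s₁ : ex μ (f * g) * ex μ (f * h) ≤ ex μ f * ex μ (f * g * h))
    (s₂ : ex μ (f * g) * ex μ (g * h) ≤ ex μ g * ex μ (f * g * h))
    (s₃ : ex μ (f * h) * ex μ (g * h) ≤ ex μ h * ex μ (f * g * h)) :
    0 ≤ sahiE μ 3 ![f, g, h] := by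
  rw [sahiE_three]
  exact cubicE3_nonneg_of_condHarris hf hg hh c₁ c₂ c₃ s₁ s₂ s₃

/-- **Quantitative form for `sahiE μ 3`** (`eᵢ ≥ 0` and the three conditional-Harris inequalities only):
`3·E f·E g·E h·E_3(f,g,h) ≥ E f E g E h·Σ E fᵢ·c_i + 2Σ E f_j E f_k·c_jc_k`, `c_i = E(f_jf_k) − E f_j E f_k`. [this work] -/
theorem sahiE_three_mul_ge_of_condHarris (μ : α → ℝ) (f g h : α → ℝ)
    (hf : 0 ≤ ex μ f) (hg : 0 ≤ ex μ g) (hh : 0 ≤ ex μ h)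
    (s₁ : ex μ (f * g) * ex μ (f * h) ≤ ex μ f * ex μ (f * g * h))
    (s₂ : ex μ (f * g) * ex μ (g * h) ≤ ex μ g * ex μ (f * g * h))
    (s₃ : ex μ (f * h) * ex μ (g * h) ≤ ex μ h * ex μ (f * g * h)) :
    ex μ f * ex μ g * ex μ h *
          (ex μ f * (ex μ (g * h) - ex μ g * ex μ h) + ex μ g * (ex μ (f * h) - ex μ f * ex μ h) +
            ex μ h * (ex μ (f * g) - ex μ f * ex μ g)) +
        2 * (ex μ g * ex μ h * ((ex μ (f * h) - ex μ f * ex μ h) * (ex μ (f * g) - ex μ f * ex μ g)) +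
              ex μ f * ex μ h * ((ex μ (g * h) - ex μ g * ex μ h) * (ex μ (f * g) - ex μ f * ex μ g)) +
              ex μ f * ex μ g * ((ex μ (g * h) - ex μ g * ex μ h) * (ex μ (f * h) - ex μ f * ex μ h))) ≤
      3 * (ex μ f * ex μ g * ex μ h) * sahiE μ 3 ![f, g, h] := by
  rw [sahiE_three]
  exact three_mul_prod_mul_cubicE3_ge hf hg hh s₁ s₂ s₃

end Functional

end Summit.CriticalPhenomena.PercolationContinuityZ3.Theorems
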